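import Literature.Barriers.CriticalPhenomena.RigorousRGSmallParameterCovariancePairAsymptotics
import Literature.Barriers.CriticalPhenomena.RigorousRGSmallParameterScalingFunctionPositivity
import HarnessLib

/-!
# `RigorousRGSmallParameter` (Slade, Theorem 1.4.1): Lemma 5.2.2 — the perturbative `β_j`
# converge, `β_j = a + O(L^{-(α∧1)j})`, with `a > 0`

Eleventh file of the §10.3–§10.4 layer and its first RG-level consequence: the coefficient `a > 0` of
the quadratic term of the recursion `g_{j+1} = g_j - β_jg_j² + …`, i.e. the existence of the
non-Gaussian perturbative fixed point `s̄ ≍ ε/a`, which the abstract critical flow of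
`RigorousRGSmallParameterFlowToMassScale.lean` takes as input (`Consts.a`, `Hyp.a_pos`, and the
scale-wise closeness `|β^W_j - a| ≤ …` of `Hyp.βW_le₁/₂`, which further needs Lemma 5.2.3).
G. Slade, *Critical exponents for long-range `O(n)` models below the upper critical dimension*,
Commun. Math. Phys. **358** (2018): "**Lemma 5.2.2.** Let `d ≥ 1` and `m² = 0`. For `j ≥ 1`, (5.26)
`β_j = a + O(L^{-(α∧1)j})` with `a = L^ε(8+n)(⟨c₀,c₀⟩ + 2Σ_{k=1}^∞L^{-εk}⟨c₀,c_k⟩) > 0`. The function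
`c₀ : ℝ^d → ℝ` is a fixed smooth function with compact support defined by (10.40), and `c_k : ℝ^d → ℝ`
is defined by `c_k(x) = L^{-(d-α)k}c₀(x/L^k)`; both are independent of `L`." Proof in §10.4,
displays (10.43)–(10.48), quoted in the docstring of `FRD.Slade2017_lem522`.

Here `β_j = PT.betaCoeff d n L α 0 j` (`= L^{-εj}(n+8)(w_{j+1}^{(2)} - w_j^{(2)})`, (5.18)/(10.43)
at `m² = 0`, for the explicit covariance decomposition of the tree), `⟨c₀,c_k⟩ = (L^k)^{α-d}I_k`
with `I_k = ∫c₀(y,0)c₀(y/L^k,0)dy` (`FRD.innerC0`, `RigorousRGSmallParameterCovariancePairAsymptotics`),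
so that `L^{-εk}⟨c₀,c_k⟩ = (L^k)^{-α}I_k` and `a = (n+8)L^{2α-d}(I_0 + 2Σ_{l≥0}(L^{l+1})^{-α}I_{l+1})`
(`FRD.aCoeff`). The rate is stated as `C(j+1)(L^j)^{-(α∧1)}`, the factor `j+1` absorbing the
logarithm at `α = 1`; `C` depends on `d, n, α, L`.

## What this file proves (everything; two definitions `FRD.aTerm`, `FRD.aCoeff`, no named fact)

* `FRD.aTerm`, `FRD.aCoeff`; `FRD.aTerm_bound` (summability, `Σ_{l≥j} ≤ (K/(1-L^{-α}))(L^{-α})^{j+1}`,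
  i.e. (10.47)); **`FRD.aCoeff_pos`** (`a > 0`).
* `FRD.rpow_err_le` (the exponent bookkeeping `L^{-j}(L^l)^{1-α} ≤ (L^j)^{-(α∧1)}`, `l ≤ j`).
* **`FRD.Slade2017_lem522`** — **Lemma 5.2.2, PROVED** (for `d ≥ 1`, `α ∈ (0,2)`, `α < d`, `L ≥ 2`,
  any `n`): `a > 0` and `|β_j - a| ≤ C(j+1)(L^j)^{-(α∧1)}` for all `j ≥ 1`.
-/

noncomputable section

namespace Literature.Barriers.CriticalPhenomena

open _root_.MeasureTheory Set Filter
open scoped _root_.Topology Real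

namespace LongRangePhi4

namespace FRD

open Literature.Probability.LatticeModels

variable {d : ℕ}

/-! ### The limit `a` of the `β_j` -/

/-- The `l`-th term of the series in `a`: `t_l = (L^{l+1})^{-α} I_{l+1} = L^{-ε(l+1)}⟨c₀,c_{l+1}⟩`
(`ε = 2α-d`, `⟨c₀,c_k⟩ = (L^k)^{α-d}I_k`). [cite: Slade2017, Lemma 5.2.2 (display (5.26): Σ_k L^{-εk}⟨c₀,c_k⟩)] -/
def aTerm (d : ℕ) (L α : ℝ) (l : ℕ) : ℝ := (L ^ (l + 1)) ^ (-α) * innerC0 d L α (l + 1)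

/-- **Slade's `a`** ((5.26), here for the `n`-component model and the explicit decomposition):
`a = (n+8)L^ε(⟨c₀,c₀⟩ + 2Σ_{k≥1}L^{-εk}⟨c₀,c_k⟩) = (n+8)L^{2α-d}(I_0 + 2Σ_{l≥0}(L^{l+1})^{-α}I_{l+1})`.
[cite: Slade2017, Lemma 5.2.2 (display (5.26))] -/
def aCoeff (d n : ℕ) (L α : ℝ) : ℝ :=
  (n + 8) * L ^ (2 * α - d) * (innerC0 d L α 0 + 2 * ∑' l : ℕ, aTerm d L α l)

/-- The series in `a` converges absolutely: `|t_l| ≤ K(L^{-α})^{l+1}`.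
[cite: Slade2017, Lemma 5.2.2 (proof, §10.4, display (10.47): Σ_{k≥j}L^{-εk}|⟨c₀,c_k⟩| ≤ O(L^{-αj}))] -/
theorem aTerm_bound (hd : 1 ≤ d) {α : ℝ} (hα0 : 0 < α) (hα2 : α < 2) {L : ℝ} (hL : 2 ≤ L) :
    ∃ K : ℝ, 0 < K ∧ (∀ l : ℕ, |aTerm d L α l| ≤ K * (L ^ (-α)) ^ (l + 1)) ∧
      Summable (aTerm d L α) ∧ (∀ l, 0 ≤ aTerm d L α l) ∧
      ∀ j : ℕ, |∑' l : ℕ, aTerm d L α (l + j)| ≤ K / (1 - L ^ (-α)) * (L ^ (-α)) ^ (j + 1) := by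
  have hL0 : (0 : ℝ) < L := by linarith
  obtain ⟨K, hK, hI⟩ := abs_innerC0_le hd hα0 hα2 hL
  set r : ℝ := L ^ (-α) with hr
  have hr0 : 0 < r := Real.rpow_pos_of_pos hL0 _
  have hr1 : r < 1 := Real.rpow_lt_one_of_one_lt_of_neg (by linarith) (by linarith)
  have hterm : ∀ l : ℕ, |aTerm d L α l| ≤ K * r ^ (l + 1) := by
    intro l
    unfold aTerm
    rw [abs_mul, abs_of_pos (Real.rpow_pos_of_pos (pow_pos hL0 _) _), hr, ← Real.rpow_mul_natCast hL0.le,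
      PT.pow_rpow_comm hL0.le, ← Real.rpow_mul_natCast hL0.le]
    rw [mul_comm]
    exact mul_le_mul_of_nonneg_right (hI _) (Real.rpow_nonneg hL0.le _)
  have hnn : ∀ l, 0 ≤ aTerm d L α l := fun l =>
    mul_nonneg (Real.rpow_nonneg (pow_pos hL0 _).le _) (innerC0_nonneg hd hα0 hα2 hL _)
  have hgeo : ∀ j : ℕ, Summable fun l : ℕ => K * r ^ (l + j + 1) := fun j => by
    have := (summable_geometric_of_lt_one hr0.le hr1).mul_left (K * r ^ (j + 1))
    refine this.congr fun l => ?_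
    rw [pow_add, pow_add, pow_one]; ring
  have hsum : Summable (aTerm d L α) := by
    refine Summable.of_nonneg_of_le hnn (fun l => ?_) (hgeo 0)
    have := hterm l
    rw [abs_of_nonneg (hnn l)] at this
    simpa using this
  refine ⟨K, hK, hterm, hsum, hnn, fun j => ?_⟩
  have htail : Summable fun l : ℕ => aTerm d L α (l + j) := (summable_nat_add_iff j).2 hsum
  rw [abs_of_nonneg (tsum_nonneg fun l => hnn _)]
  calc ∑' l : ℕ, aTerm d L α (l + j) ≤ ∑' l : ℕ, K * r ^ (l + j + 1) := by
        refine Summable.tsum_le_tsum (fun l => ?_) htail (hgeo j)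
        have := hterm (l + j)
        rwa [abs_of_nonneg (hnn _)] at this
    _ = K * r ^ (j + 1) * ∑' l : ℕ, r ^ l := by
        rw [← tsum_mul_left]
        refine tsum_congr fun l => ?_
        rw [pow_add, pow_add, pow_one]; ring
    _ = K / (1 - r) * r ^ (j + 1) := by
        rw [tsum_geometric_of_lt_one hr0.le hr1]
        have : 1 - r ≠ 0 := by linarith
        field_simp

/-- **`a > 0`** ("each inner product … is nonnegative, with the first term strictly positive").
[cite: Slade2017, Lemma 5.2.2 ("with a > 0") and its proof, §10.4] -/
theorem aCoeff_pos (hd : 1 ≤ d) (n : ℕ) {α : ℝ} (hα0 : 0 < α) (hα2 : α < 2) {L : ℝ} (hL : 2 ≤ L) :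
    0 < aCoeff d n L α := by
  have hL0 : (0 : ℝ) < L := by linarith
  obtain ⟨-, -, -, -, hnn, -⟩ := aTerm_bound hd hα0 hα2 hL
  have h0 : 0 < innerC0 d L α 0 := by
    unfold innerC0
    have e : (fun y : Fin d → ℝ => cZero d L α y 0 * cZero d L α (fun i => y i / L ^ 0) 0) =
        fun y => cZero d L α y 0 * cZero d L α y 0 := by
      funext y; simp
    rw [e]
    exact integral_cZero_sq_pos hd hα0 hα2 hL
  unfold aCoeff
  have h1 : 0 ≤ ∑' l : ℕ, aTerm d L α l := tsum_nonneg hnn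
  have h2 : 0 < L ^ (2 * α - d) := Real.rpow_pos_of_pos hL0 _
  have : (0 : ℝ) < n + 8 := by positivity
  positivity

/-! ### Exponent bookkeeping -/

/-- For `1 ≤ L`, `l ≤ j`, `m = min α 1`: `L^{-j}(L^l)^{1-α} ≤ (L^j)^{-m}` (both regimes `α ≤ 1`,
`α ≥ 1` of the error sum `Σ_kL^{εk}O(L^{-k-(d-α)(j-k)})`). [cite: Slade2017, Lemma 5.2.2 (proof, §10.4: "= L^{ε(j+1)}(… + O(L^{-(α∧1)j}))")] -/
theorem rpow_err_le {L : ℝ} (hL : 1 ≤ L) (α : ℝ) {l j : ℕ} (hlj : l ≤ j) :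
    L ^ (-(j : ℝ)) * (L ^ l) ^ (1 - α) ≤ (L ^ j) ^ (-min α 1) := by
  have hL0 : 0 < L := by linarith
  rw [← Real.rpow_natCast L l, ← Real.rpow_mul hL0.le, ← Real.rpow_add hL0, ← Real.rpow_natCast L j,
    ← Real.rpow_mul hL0.le]
  apply Real.rpow_le_rpow_of_exponent_le hL
  have hlj' : (l : ℝ) ≤ j := by exact_mod_cast hlj
  have hl0 : (0 : ℝ) ≤ l := Nat.cast_nonneg l
  rcases le_or_gt α 1 with hα1 | hα1
  · rw [min_eq_left hα1]
    nlinarith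
  · rw [min_eq_right hα1.le]
    nlinarith

/-! ### Lemma 5.2.2 -/

/-- **Slade, Lemma 5.2.2, PROVED for the explicit decomposition** (massless case, `n`-component
model): "Let `d ≥ 1` and `m² = 0`. For `j ≥ 1`, (5.26) `β_j = a + O(L^{-(α∧1)j})` with
`a = L^ε(8+n)(⟨c₀,c₀⟩ + 2Σ_{k=1}^∞L^{-εk}⟨c₀,c_k⟩) > 0`. The function `c₀ : ℝ^d → ℝ` is a fixed
smooth function with compact support …, and `c_k : ℝ^d → ℝ` is defined by `c_k(x) =
L^{-(d-α)k}c₀(x/L^k)`; both are independent of `L`." Here `β_j = PT.betaCoeff d n L α 0 j`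
(`= L^{-εj}(n+8)(w_{j+1}^{(2)} - w_j^{(2)})`, (10.43)), `a = FRD.aCoeff d n L α`, and the rate is
`C(j+1)(L^j)^{-(α∧1)}` (the factor `j+1` covers the logarithmic case `α = 1`). Printed proof (§10.4)
followed: (10.43) `β_j = (8+n)L^{-εj}((C_{j+1},C_{j+1}) + 2Σ_{k=1}^j(C_k,C_{j+1}))`
[`PT.powSum_two_succ_sub`]; (10.45) for `k ≥ 2` [`FRD.sum_fracCov_mul_fracCov_asymp`] and a crude
bound for `k = 1`; `Σ_{k=1}^j(C_k,C_{j+1}) = L^{ε(j+1)}(Σ_{k=1}^jL^{-εk}⟨c₀,c_k⟩ + O(L^{-(α∧1)j}))`,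
`(C_{j+1},C_{j+1}) = L^{ε(j+1)}(⟨c₀,c₀⟩ + O(L^{-pj}))`; (10.47) `Σ_{k≥j}L^{-εk}|⟨c₀,c_k⟩| ≤ O(L^{-αj})`
[`FRD.aTerm_bound`]; positivity of `a` [`FRD.aCoeff_pos`].
[cite: Slade2017, Lemma 5.2.2 (display (5.26)) and its proof, §10.4 (displays (10.43)–(10.48))] -/
theorem Slade2017_lem522 (hd : 1 ≤ d) (n : ℕ) {α : ℝ} (hα0 : 0 < α) (hα2 : α < 2) (hαd : α < d)
    {L : ℝ} (hL : 2 ≤ L) :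
    0 < aCoeff d n L α ∧ ∃ C : ℝ, 0 < C ∧ ∀ j : ℕ, 1 ≤ j →
      |PT.betaCoeff d n L α 0 j - aCoeff d n L α| ≤ C * (j + 1) * (L ^ j) ^ (-min α 1) := by
  refine ⟨aCoeff_pos hd n hα0 hα2 hL, ?_⟩
  have hd' : (1 : ℝ) ≤ d := by exact_mod_cast hd
  have hL1 : (1 : ℝ) ≤ L := by linarith
  have hL0 : (0 : ℝ) < L := by linarith
  have hn8 : (0 : ℝ) < n + 8 := by positivity
  obtain ⟨CA, hCA, hA⟩ := sum_fracCov_mul_fracCov_asymp hd hα0 hα2 hL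
  obtain ⟨c, hc, hCb⟩ := PT.abs_fracCov_le_massFactor hd hα0 hα2 hαd (le_refl (0 : ℝ))
  obtain ⟨K, hK, -, hsum, hnn, htail⟩ := aTerm_bound hd hα0 hα2 hL
  set r : ℝ := L ^ (-α) with hr
  have hr0 : 0 < r := Real.rpow_pos_of_pos hL0 _
  have hr1 : r < 1 := Real.rpow_lt_one_of_one_lt_of_neg (by linarith) (by linarith)
  set m : ℝ := min α 1 with hm
  have hm1 : m ≤ 1 := min_le_right _ _
  have hmα : m ≤ α := min_le_left _ _
  -- exponent bookkeeping helpers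
  have hnat : ∀ (k : ℕ) (e : ℝ), (L ^ k) ^ e = L ^ ((k : ℝ) * e) := fun k e => by
    rw [← Real.rpow_natCast, ← Real.rpow_mul hL0.le]
  have hpow : ∀ (e : ℝ) (k : ℕ), (L ^ e) ^ k = L ^ (e * k) := fun e k => by
    rw [← Real.rpow_mul_natCast hL0.le]
  have hmul : ∀ a b : ℝ, L ^ a * L ^ b = L ^ (a + b) := fun a b => (Real.rpow_add hL0 a b).symm
  have hinvr : ∀ a : ℝ, (L ^ a)⁻¹ = L ^ (-a) := fun a => (Real.rpow_neg hL0.le a).symm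
  have hnatr : ∀ k : ℕ, (L ^ k : ℝ) = L ^ (k : ℝ) := fun k => (Real.rpow_natCast L k).symm
  -- the constant
  set Ctot : ℝ := (n + 8) * (CA * L ^ (2 * α - d) + 2 * ((L + 1) ^ d * (c * c)) + 2 * CA * L ^ (α - d) +
    2 * L ^ (2 * α - d) * (K / (1 - r))) with hCtot
  have hCtot0 : 0 < Ctot := by
    have : 0 < 1 - r := by linarith
    have := Real.rpow_pos_of_pos hL0 (2 * α - d)
    have := Real.rpow_pos_of_pos hL0 (α - d)
    positivity
  refine ⟨Ctot, hCtot0, fun j hj => ?_⟩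
  have hΛ1 : (1 : ℝ) ≤ L ^ j := one_le_pow₀ hL1
  have hΛ0 : (0 : ℝ) < L ^ j := by positivity
  -- `(L^j)^{-α}, (L^j)^{-1} ≤ (L^j)^{-m}`
  have hαm : (L ^ j) ^ (-α) ≤ (L ^ j) ^ (-m) := Real.rpow_le_rpow_of_exponent_le hΛ1 (by linarith)
  have h1m : (L ^ j)⁻¹ ≤ (L ^ j) ^ (-m) := by
    rw [← Real.rpow_neg_one]; exact Real.rpow_le_rpow_of_exponent_le hΛ1 (by linarith)
  have hΛm0 : 0 < (L ^ j) ^ (-m) := Real.rpow_pos_of_pos hΛ0 _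
  -- Step 1: `β_j = P (n+8) D`
  set P : ℝ := ((L ^ (2 * α - d)) ^ j)⁻¹ with hP
  have hPr : P = L ^ (-((2 * α - d) * j)) := by rw [hP, hpow, hinvr]
  have hP0 : 0 < P := by rw [hPr]; exact Real.rpow_pos_of_pos hL0 _
  set S : Finset (Site d) := PT.ball (L ^ (j + 1) / 2) with hS
  have hβ : PT.betaCoeff d n L α 0 j = P * ((n + 8) * ∑ x ∈ S, fracCov d L α 0 (j + 1) x *
      (PT.wCov d L α 0 j x + PT.wCov d L α 0 (j + 1) x)) := by
    unfold PT.betaCoeff PT.betaPrime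
    rw [PT.scaleMin_of_not_pos (lt_irrefl (0 : ℝ)), ← PT.powSum_two_succ_sub hd hL1 α 0 j]
  -- Step 2: `D = Q + 2 Σ_{k∈Icc 1 j} P_k`
  set Q : ℝ := ∑ x ∈ S, fracCov d L α 0 (j + 1) x * fracCov d L α 0 (j + 1) x with hQ
  set Pk : ℕ → ℝ := fun k => ∑ x ∈ S, fracCov d L α 0 k x * fracCov d L α 0 (j + 1) x with hPk
  have hD : ∑ x ∈ S, fracCov d L α 0 (j + 1) x * (PT.wCov d L α 0 j x + PT.wCov d L α 0 (j + 1) x) =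
      Q + 2 * ∑ k ∈ Finset.Icc 1 j, Pk k := by
    have e : ∀ x, PT.wCov d L α 0 j x + PT.wCov d L α 0 (j + 1) x =
        (∑ k ∈ Finset.Icc 1 j, 2 * fracCov d L α 0 k x) + fracCov d L α 0 (j + 1) x := by
      intro x
      rw [PT.wCov_succ, ← Finset.mul_sum]
      unfold PT.wCov
      ring
    have e2 : ∀ x, fracCov d L α 0 (j + 1) x * (PT.wCov d L α 0 j x + PT.wCov d L α 0 (j + 1) x) =
        (∑ k ∈ Finset.Icc 1 j, 2 * (fracCov d L α 0 k x * fracCov d L α 0 (j + 1) x)) +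
          fracCov d L α 0 (j + 1) x * fracCov d L α 0 (j + 1) x := by
      intro x
      rw [e x, mul_add, Finset.mul_sum]
      congr 1
      refine Finset.sum_congr rfl fun k _ => by ring
    rw [Finset.sum_congr rfl fun x _ => e2 x, Finset.sum_add_distrib, Finset.sum_comm, add_comm, hQ]
    congr 1
    rw [Finset.mul_sum]
    refine Finset.sum_congr rfl fun k _ => ?_
    rw [hPk]
    simp only []
    rw [Finset.mul_sum]
  -- Step 3: split off `k = 1` and reindex `k = j - l`, `l ∈ range (j-1)`
  have hsplit : ∑ k ∈ Finset.Icc 1 j, Pk k = Pk 1 + ∑ l ∈ Finset.range (j - 1), Pk (j - l) := by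
    rw [Finset.Icc_eq_cons_Ioc hj, Finset.sum_cons]
    congr 1
    refine Finset.sum_nbij' (fun k => j - k) (fun l => j - l) (fun k hk => ?_) (fun l hl => ?_)
      (fun k hk => ?_) (fun l hl => ?_) (fun k hk => ?_)
    · rw [Finset.mem_Ioc] at hk; rw [Finset.mem_range]; omega
    · rw [Finset.mem_range] at hl; rw [Finset.mem_Ioc]; omega
    · rw [Finset.mem_Ioc] at hk; omega
    · rw [Finset.mem_range] at hl; omega
    · rw [Finset.mem_Ioc] at hk; congr 1; omega
  -- Step 4a: the diagonal term
  have hQb : |P * Q - L ^ (2 * α - d) * innerC0 d L α 0| ≤ CA * L ^ (2 * α - d) * (L ^ j) ^ (-m) := by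
    have h := hA (j + 1) (by omega) 0
    rw [← hS, show j + 1 + 0 = j + 1 by rfl, pow_zero, Real.one_rpow, mul_one, mul_one] at h
    -- `P (L^{j+1})^{ε} = L^{ε}`
    have e1 : P * (L ^ (j + 1)) ^ (2 * α - d) = L ^ (2 * α - d) := by
      rw [hPr, hnat, hmul]; congr 1; push_cast; ring
    have e2 : P * Q - L ^ (2 * α - d) * innerC0 d L α 0 =
        P * (Q - (L ^ (j + 1)) ^ (2 * α - d) * innerC0 d L α 0) := by rw [mul_sub, ← mul_assoc, e1]
    rw [e2, abs_mul, abs_of_pos hP0]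
    calc P * |Q - (L ^ (j + 1)) ^ (2 * α - d) * innerC0 d L α 0|
        ≤ P * (CA * (L ^ (j + 1)) ^ (2 * α - d) * (L ^ (j + 1))⁻¹) := mul_le_mul_of_nonneg_left h hP0.le
      _ = CA * (P * (L ^ (j + 1)) ^ (2 * α - d)) * (L ^ (j + 1))⁻¹ := by ring
      _ = CA * L ^ (2 * α - d) * (L ^ (j + 1))⁻¹ := by rw [e1]
      _ ≤ CA * L ^ (2 * α - d) * (L ^ j) ^ (-m) := by
          refine mul_le_mul_of_nonneg_left ?_ (by positivity)
          refine le_trans ?_ h1m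
          exact inv_anti₀ hΛ0 (pow_le_pow_right₀ hL1 (by omega))
  -- Step 4b: the `k = 1` term
  have hP1b : |P * Pk 1| ≤ (L + 1) ^ d * (c * c) * (L ^ j) ^ (-m) := by
    have hsub : PT.ball (L ^ 1 / 2) ⊆ S := fun x hx => by
      rw [PT.mem_ball] at hx
      rw [hS, PT.mem_ball]
      exact lt_of_lt_of_le hx (div_le_div_of_nonneg_right (pow_le_pow_right₀ hL1 (by omega)) (by norm_num))
    have e1 : Pk 1 = ∑ x ∈ PT.ball (L ^ 1 / 2), fracCov d L α 0 1 x * fracCov d L α 0 (j + 1) x :=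
      sum_fracCov_mul_eq_sum_ball hd hL1 α 0 (j + 1) (le_refl _) S hsub
    have hmass : ∀ i, PT.massFactor L α 0 i = 1 := fun i => by simp [PT.massFactor]
    have hb1 : ∀ x, |fracCov d L α 0 1 x| ≤ c := by
      intro x
      have := hCb L hL 0 le_rfl le_rfl 1 le_rfl x
      simpa [hmass] using this
    have hbj : ∀ x, |fracCov d L α 0 (j + 1) x| ≤ c * (L ^ j) ^ (α - d) := by
      intro x
      have := hCb L hL 0 le_rfl le_rfl (j + 1) (by omega) x
      simpa [hmass] using this
    have hcard : ((PT.ball (d := d) (L ^ 1 / 2)).card : ℝ) ≤ (L + 1) ^ d := by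
      refine (PT.card_ball_le (by positivity)).trans (le_of_eq ?_)
      rw [pow_one]; ring
    have hsumb : |Pk 1| ≤ (L + 1) ^ d * (c * (c * (L ^ j) ^ (α - d))) := by
      rw [e1]
      calc |∑ x ∈ PT.ball (L ^ 1 / 2), fracCov d L α 0 1 x * fracCov d L α 0 (j + 1) x|
          ≤ ∑ x ∈ PT.ball (L ^ 1 / 2), |fracCov d L α 0 1 x * fracCov d L α 0 (j + 1) x| :=
            Finset.abs_sum_le_sum_abs _ _
        _ ≤ ∑ _x ∈ PT.ball (L ^ 1 / 2), c * (c * (L ^ j) ^ (α - d)) := Finset.sum_le_sum fun x _ => by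
            rw [abs_mul]; exact mul_le_mul (hb1 x) (hbj x) (abs_nonneg _) hc.le
        _ = (PT.ball (d := d) (L ^ 1 / 2)).card * (c * (c * (L ^ j) ^ (α - d))) := by
            rw [Finset.sum_const, nsmul_eq_mul]
        _ ≤ (L + 1) ^ d * (c * (c * (L ^ j) ^ (α - d))) :=
            mul_le_mul_of_nonneg_right hcard (by have := Real.rpow_pos_of_pos hΛ0 (α - d); positivity)
    -- `P (L^j)^{α-d} = (L^j)^{-α}`
    have e2 : P * (L ^ j) ^ (α - d) = (L ^ j) ^ (-α) := by
      rw [hPr, hnat, hnat, hmul]; congr 1; ring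
    rw [abs_mul, abs_of_pos hP0]
    calc P * |Pk 1| ≤ P * ((L + 1) ^ d * (c * (c * (L ^ j) ^ (α - d)))) := mul_le_mul_of_nonneg_left hsumb hP0.le
      _ = (L + 1) ^ d * (c * c) * (P * (L ^ j) ^ (α - d)) := by ring
      _ = (L + 1) ^ d * (c * c) * (L ^ j) ^ (-α) := by rw [e2]
      _ ≤ (L + 1) ^ d * (c * c) * (L ^ j) ^ (-m) := mul_le_mul_of_nonneg_left hαm (by positivity)
  -- Step 4c: the terms `k = j - l ≥ 2`, `l < j - 1`
  have hPkb : ∀ l ∈ Finset.range (j - 1),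
      |P * Pk (j - l) - L ^ (2 * α - d) * aTerm d L α l| ≤ CA * L ^ (α - d) * (L ^ j) ^ (-m) := by
    intro l hl
    rw [Finset.mem_range] at hl
    have hk2 : 2 ≤ j - l := by omega
    have hsub : PT.ball (L ^ (j - l) / 2) ⊆ S := fun x hx => by
      rw [PT.mem_ball] at hx
      rw [hS, PT.mem_ball]
      exact lt_of_lt_of_le hx (div_le_div_of_nonneg_right (pow_le_pow_right₀ hL1 (by omega)) (by norm_num))
    have e1 : Pk (j - l) = ∑ x ∈ PT.ball (L ^ (j - l) / 2), fracCov d L α 0 (j - l) x * fracCov d L α 0 (j + 1) x :=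
      sum_fracCov_mul_eq_sum_ball hd hL1 α 0 (j + 1) (le_refl _) S hsub
    have h := hA (j - l) hk2 (l + 1)
    rw [show j - l + (l + 1) = j + 1 by omega] at h
    rw [e1]
    -- exponent identities
    have hjl : ((j - l : ℕ) : ℝ) = j - l := by push_cast [Nat.cast_sub (by omega : l ≤ j)]; ring
    have e2 : P * (L ^ (j - l)) ^ (2 * α - d) * (L ^ (l + 1)) ^ (α - d) = L ^ (α - d) * (L ^ l) ^ (-α) := by
      rw [hPr, hnat, hnat, hnat, hmul, hmul, hmul, hjl]; congr 1; push_cast; ring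
    have e3 : L ^ (2 * α - d) * aTerm d L α l = L ^ (α - d) * (L ^ l) ^ (-α) * innerC0 d L α (l + 1) := by
      unfold aTerm
      rw [← mul_assoc]; congr 1
      rw [hnat, hnat, hmul, hmul]; congr 1; push_cast; ring
    have e4 : P * (∑ x ∈ PT.ball (L ^ (j - l) / 2), fracCov d L α 0 (j - l) x * fracCov d L α 0 (j + 1) x) -
        L ^ (2 * α - d) * aTerm d L α l =
        P * ((∑ x ∈ PT.ball (L ^ (j - l) / 2), fracCov d L α 0 (j - l) x * fracCov d L α 0 (j + 1) x) -
          (L ^ (j - l)) ^ (2 * α - d) * (L ^ (l + 1)) ^ (α - d) * innerC0 d L α (l + 1)) := by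
      rw [e3, ← e2]; ring
    rw [e4, abs_mul, abs_of_pos hP0]
    calc P * |(∑ x ∈ PT.ball (L ^ (j - l) / 2), fracCov d L α 0 (j - l) x * fracCov d L α 0 (j + 1) x) -
          (L ^ (j - l)) ^ (2 * α - d) * (L ^ (l + 1)) ^ (α - d) * innerC0 d L α (l + 1)|
        ≤ P * (CA * (L ^ (j - l)) ^ (2 * α - d) * (L ^ (l + 1)) ^ (α - d) * (L ^ (j - l))⁻¹) :=
          mul_le_mul_of_nonneg_left h hP0.le
      _ = CA * (P * (L ^ (j - l)) ^ (2 * α - d) * (L ^ (l + 1)) ^ (α - d)) * (L ^ (j - l))⁻¹ := by ring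
      _ = CA * (L ^ (α - d) * (L ^ l) ^ (-α)) * (L ^ (j - l))⁻¹ := by rw [e2]
      _ = CA * L ^ (α - d) * (L ^ (-(j : ℝ)) * (L ^ l) ^ (1 - α)) := by
          have e5 : (L ^ l) ^ (-α) * (L ^ (j - l) : ℝ)⁻¹ = L ^ (-(j : ℝ)) * (L ^ l) ^ (1 - α) := by
            rw [hnatr (j - l), hinvr, hjl, hnat, hnat, hmul, hmul]
            congr 1; ring
          rw [← e5]; ring
      _ ≤ CA * L ^ (α - d) * (L ^ j) ^ (-m) := by
          refine mul_le_mul_of_nonneg_left (rpow_err_le hL1 α (by omega : l ≤ j)) ?_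
          have := Real.rpow_pos_of_pos hL0 (α - d); positivity
  -- Step 5: assemble
  have htsum : ∑' l : ℕ, aTerm d L α l = (∑ l ∈ Finset.range (j - 1), aTerm d L α l) +
      ∑' l : ℕ, aTerm d L α (l + (j - 1)) := (hsum.sum_add_tsum_nat_add (j - 1)).symm
  have hdiff : PT.betaCoeff d n L α 0 j - aCoeff d n L α =
      (n + 8) * ((P * Q - L ^ (2 * α - d) * innerC0 d L α 0) + 2 * (P * Pk 1) +
        2 * (∑ l ∈ Finset.range (j - 1), (P * Pk (j - l) - L ^ (2 * α - d) * aTerm d L α l)) -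
        2 * L ^ (2 * α - d) * ∑' l : ℕ, aTerm d L α (l + (j - 1))) := by
    rw [hβ, hD, hsplit]
    unfold aCoeff
    rw [htsum, Finset.sum_sub_distrib, ← Finset.mul_sum, ← Finset.mul_sum]
    ring
  rw [hdiff, abs_mul, abs_of_pos hn8]
  have hsumPk : |∑ l ∈ Finset.range (j - 1), (P * Pk (j - l) - L ^ (2 * α - d) * aTerm d L α l)| ≤
      (j - 1 : ℕ) * (CA * L ^ (α - d) * (L ^ j) ^ (-m)) := by
    calc |∑ l ∈ Finset.range (j - 1), (P * Pk (j - l) - L ^ (2 * α - d) * aTerm d L α l)|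
        ≤ ∑ l ∈ Finset.range (j - 1), |P * Pk (j - l) - L ^ (2 * α - d) * aTerm d L α l| :=
          Finset.abs_sum_le_sum_abs _ _
      _ ≤ ∑ _l ∈ Finset.range (j - 1), CA * L ^ (α - d) * (L ^ j) ^ (-m) := Finset.sum_le_sum hPkb
      _ = _ := by rw [Finset.sum_const, Finset.card_range, nsmul_eq_mul]
  have htailb : |2 * L ^ (2 * α - d) * ∑' l : ℕ, aTerm d L α (l + (j - 1))| ≤
      2 * L ^ (2 * α - d) * (K / (1 - r)) * (L ^ j) ^ (-m) := by
    have hε0 : 0 < L ^ (2 * α - d) := Real.rpow_pos_of_pos hL0 _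
    rw [abs_mul, abs_of_pos (by positivity : (0 : ℝ) < 2 * L ^ (2 * α - d))]
    have h := htail (j - 1)
    rw [show j - 1 + 1 = j by omega] at h
    have hrj : r ^ j = (L ^ j) ^ (-α) := by rw [hr, hpow, hnat]; congr 1; ring
    have h1r : 0 < 1 - r := by linarith
    calc 2 * L ^ (2 * α - d) * |∑' l : ℕ, aTerm d L α (l + (j - 1))|
        ≤ 2 * L ^ (2 * α - d) * (K / (1 - r) * r ^ j) := mul_le_mul_of_nonneg_left h (by positivity)
      _ = 2 * L ^ (2 * α - d) * (K / (1 - r)) * (L ^ j) ^ (-α) := by rw [hrj]; ring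
      _ ≤ 2 * L ^ (2 * α - d) * (K / (1 - r)) * (L ^ j) ^ (-m) := mul_le_mul_of_nonneg_left hαm (by positivity)
  -- final assembly
  have hε0 : 0 < L ^ (2 * α - d) := Real.rpow_pos_of_pos hL0 _
  have hαd0 : 0 < L ^ (α - d) := Real.rpow_pos_of_pos hL0 _
  have h1r : 0 < 1 - r := by linarith
  have hj1 : ((j - 1 : ℕ) : ℝ) ≤ j + 1 := by
    have : ((j - 1 : ℕ) : ℝ) = j - 1 := by push_cast [Nat.cast_sub hj]; ring
    rw [this]; linarith
  have hj0 : (1 : ℝ) ≤ j + 1 := by linarith [Nat.cast_nonneg (α := ℝ) j]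
  have hX := hΛm0.le
  calc (n + 8 : ℝ) * |(P * Q - L ^ (2 * α - d) * innerC0 d L α 0) + 2 * (P * Pk 1) +
        2 * (∑ l ∈ Finset.range (j - 1), (P * Pk (j - l) - L ^ (2 * α - d) * aTerm d L α l)) -
        2 * L ^ (2 * α - d) * ∑' l : ℕ, aTerm d L α (l + (j - 1))|
      ≤ (n + 8) * (|P * Q - L ^ (2 * α - d) * innerC0 d L α 0| + 2 * |P * Pk 1| +
          2 * |∑ l ∈ Finset.range (j - 1), (P * Pk (j - l) - L ^ (2 * α - d) * aTerm d L α l)| +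
          |2 * L ^ (2 * α - d) * ∑' l : ℕ, aTerm d L α (l + (j - 1))|) := by
        refine mul_le_mul_of_nonneg_left ?_ hn8.le
        refine (abs_sub _ _).trans (add_le_add ?_ le_rfl)
        refine (abs_add_le _ _).trans (add_le_add ((abs_add_le _ _).trans (add_le_add le_rfl ?_)) ?_)
        · rw [abs_mul, abs_of_pos (by norm_num : (0 : ℝ) < 2)]
        · rw [abs_mul, abs_of_pos (by norm_num : (0 : ℝ) < 2)]
    _ ≤ (n + 8) * (CA * L ^ (2 * α - d) * (L ^ j) ^ (-m) + 2 * ((L + 1) ^ d * (c * c) * (L ^ j) ^ (-m)) +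
          2 * ((j - 1 : ℕ) * (CA * L ^ (α - d) * (L ^ j) ^ (-m))) +
          2 * L ^ (2 * α - d) * (K / (1 - r)) * (L ^ j) ^ (-m)) := by
        refine mul_le_mul_of_nonneg_left ?_ hn8.le
        exact add_le_add (add_le_add (add_le_add hQb (mul_le_mul_of_nonneg_left hP1b (by norm_num)))
          (mul_le_mul_of_nonneg_left hsumPk (by norm_num))) htailb
    _ = (n + 8) * (CA * L ^ (2 * α - d) * 1 + 2 * ((L + 1) ^ d * (c * c)) * 1 +
          2 * CA * L ^ (α - d) * ((j - 1 : ℕ) : ℝ) + 2 * L ^ (2 * α - d) * (K / (1 - r)) * 1) * (L ^ j) ^ (-m) := by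
        ring
    _ ≤ (n + 8) * (CA * L ^ (2 * α - d) * (j + 1) + 2 * ((L + 1) ^ d * (c * c)) * (j + 1) +
          2 * CA * L ^ (α - d) * (j + 1) + 2 * L ^ (2 * α - d) * (K / (1 - r)) * (j + 1)) * (L ^ j) ^ (-m) := by
        refine mul_le_mul_of_nonneg_right (mul_le_mul_of_nonneg_left ?_ hn8.le) hX
        gcongr
    _ = Ctot * (j + 1) * (L ^ j) ^ (-m) := by rw [hCtot]; ring

end FRD

end LongRangePhi4

end Literature.Barriers.CriticalPhenomena
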